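import Summits.QuantumFields.YangMills.Theses.FlatTubeReduction
import Summits.QuantumFields.YangMills.Theorems.FlatTubeReductionRecordProfileAnalyticInput
import Summits.QuantumFields.YangMills.Theorems.FlatTubeReductionRateTwoZonePow
import Summits.QuantumFields.YangMills.Theorems.FlatTubeReductionShellGainOfSmall
import Summits.QuantumFields.YangMills.Theorems.FlatTubeReductionRecordAnalyticRate
import Summits.QuantumFields.YangMills.Theorems.FlatTubeReductionSoftTubeRatePot
import Summits.QuantumFields.YangMills.Theorems.FlatTubeReductionBOAssemblyRatePot
import Summits.QuantumFields.YangMills.Theorems.FlatTubeReductionHODPotA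
import Summits.QuantumFields.YangMills.Theorems.FlatTubeReductionCentralQuasimodeThird
import Summits.QuantumFields.YangMills.Theorems.LuscherReductionTwistedTraceScalingValleyGainRecord
import Summits.QuantumFields.YangMills.Theorems.FlatTubeReductionStiffKHST
import HarnessLib

/-!
# ★★★★ Crux K1 `NearFlatRatioLaw` of route `FlatTubeReduction` — the assembled proof of line «ratepack_v2» (skeleton v8, all stubs landed)
# (route `FlatTubeReduction`, crux K1 stmt-QuantumFields-24720; seat `ym-line-ftr-p1` g10–g20; R2b1 RECORD rung — a fixed-lattice semiclassical statement; no summit statement is proved here)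

THE LINE (crux workfiles `Cruxes/NearFlatRatioLaw/Lines/ratepack_v2.{lean,md}`, `ratepack-v3-frozen-g12.md` … `ratepack-v8-core-g19.md`): two zones at core exponent `s = 1/6`.
* CORE RATE for every `L ≥ 2` (`coreRate`): ONE inhabitant of `RateTube.AnalyticRatePotInput L D_L M` (`D_L = max 1 (|Site 3 L|/7)`, window `D_L·recordDelta1 L (1/6)`, weight
  `recordChi L (1/6) (42D_L+1) M`) via `AnalyticRatePotInput.toRecord → boRateBricksPot_record → softTubeBORatePackagePotOn_of_bricksPot → innerRateAt_of_ratePackagePot`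
  ((EM) = ✓`RateTube.oneSiteEigenMoments`); the inhabitant from the two analytic bricks by ✓`recordProfile_analyticInput_of_hST_hOD`:
  - (B-ST) at the rate twin's window: ✓`ConstTube.stub_hST_A` (`Theorems/FlatTubeReductionStiffKHST.lean`; the K-port `43 ↦ 42D_L+1` of lane A's ✓`hST_record_low`,
    files `Theorems/FlatTubeReductionStiffK*.lean`);
  - (B-OD) with second-moment potential at rate `O(λ_b²)`: ✓`ConstTube.hODpot_A_of_quasimode` ∘ ✓`ConstTube.stub_C1rate` (central quasimode at rate `β^{-1/3}`).
* SHELL: lane A's UNCONDITIONAL small-action shell gain ✓`shellGain_record` at `a = 1/6` + ✓`innerShellGainAt_of_small_record` (`shellGain_sixth`).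
* GLUE: ✓`nearFlatRatioLaw_of_coreRate_shell_pow` (IMS cut at `β^{-1/6}` costing `O(λ_b²)λ₀`).
★★★★ `FlatTubeReduction.nearFlatRatioLaw_proof : Summit.QuantumFields.YangMills.Theses.FlatTubeReduction.NearFlatRatioLaw`.
HONEST FRAMING: a fixed-lattice (every `L ≥ 2`, eventually in `β`) Born–Oppenheimer ratio law in the flat tube; femto rung R2b1 carries the RECORD label; this is NOT infinite volume,
NOT a mass gap, NOT Clay; no summit statement is proved here.  No `sorry`, no new definitions, no named-fact hypotheses.
-/

set_option autoImplicit false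

noncomputable section

open MeasureTheory Filter Topology
open Literature.MathematicalPhysics.QuantumFieldTheory hiding SU2
open Literature.MathematicalPhysics.QuantumLattice
open Summit.QuantumFields.YangMills.Theorems.FemtoTransferGap
open Summit.QuantumFields.YangMills.Theorems.FemtoTransferGap.TwoLattice
open Summit.QuantumFields.YangMills.Theorems.FemtoTransferGap.TwoLattice.ConstTube
open Summit.QuantumFields.YangMills.Theorems.FemtoTransferGap.TwoLattice.Avg
open Summit.QuantumFields.YangMills.Theorems.FemtoTransferGap.RateTube
open Summit.QuantumFields.YangMills.Theorems.FemtoTransferGap.TwoLattice.GnChart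
open Summit.QuantumFields.YangMills.Theorems.FemtoTransferGap.TwoLattice.Stiff
open Summit.QuantumFields.YangMills.Theorems.FemtoTransferGap.TwoLattice.Cov
open scoped BigOperators

namespace Summit.QuantumFields.YangMills.Theorems.FemtoTransferGap.RateTube.NearFlatRatioLawLine

/-- The action-free SHELL GAIN at the radii the two-zone glue needs, `InnerShellGainAt L (β^{-1/6}) (β^{-1/40})` for every `L ≥ 2`: lane A's
UNCONDITIONAL small-action shell gain ✓`shellGain_record` at inner exponent `a = 1/6 < 1/5` (outer exponent free), then ✓`innerShellGainAt_of_small_record` (action phase split at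
`η = β^{-17/20}`).  (The formerly registered `stub_shellGainSmall` asked for `a = 1/5`, which the glue only used through core monotonicity `β^{-1/5} ≤ β^{-1/6}`.) [cite: Luscher1983, §3] -/
theorem shellGain_sixth :
    ∀ (L : ℕ) [NeZero L], 2 ≤ L → InnerShellGainAt L (powScale (1 / 6)) (powScale (1 / 40)) := fun L _ hL =>
  innerShellGainAt_of_small_record (shellGain_record (L := L) hL (a := 1 / 6) (by norm_num) (by norm_num) (1 / 40))

/-- `L ≥ 2` has a non-zero site. [folklore] -/
theorem nonempty_nzSite (L : ℕ) [NeZero L] (hL : 2 ≤ L) : Nonempty (NzSite L) := by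
  haveI : Fact (1 < L) := ⟨hL⟩
  exact ⟨⟨fun _ => 1, fun h => one_ne_zero (congrFun h 0)⟩⟩

/-- ★ The (B-OD) BRICK WITH SECOND-MOMENT POTENTIAL at rate `b_A² = O(λ_b(L³β)²)` for the un-normalised record profile (v6's `stub_hODpot_A`): ✓`…HODPotA.hODpot_A_of_quasimode` ∘ ✓`ConstTube.stub_C1rate`.
[cite: Luscher1983, §3] -/
theorem hODpot_A :
    ∀ (L : ℕ) [NeZero L], 2 ≤ L → ∃ M₂ : ℝ, ∀ M : ℝ, M₂ ≤ M → ∃ (bA : ℝ → ℝ) (κA : ℝ), 0 ≤ κA ∧ (∀ β, 0 ≤ bA β) ∧ (∃ a : ℝ, ∀ᶠ β : ℝ in atTop, bA β ^ 2 ≤ a * bareLambda ((L : ℝ) ^ 3 * β) ^ 2) ∧ ∀ᶠ β : ℝ in atTop, ∀ (φ : GaugeConfig 3 1 SU2 → ℝ) (v : GaugeConfig 3 L SU2 → ℝ), Measurable φ → (∃ C : ℝ, ∀ u, |φ u| ≤ C) → (∀ (g : Site 3 1 → SU2) (u : GaugeConfig 3 1 SU2), φ (gaugeTransform g u) = φ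 u) → (∀ u, φ u ≠ 0 → orbitDist u < max 1 ((Fintype.card (Site 3 L) : ℝ) / 7) * recordDelta1 L (1 / 6) β) → Measurable v → (∃ C : ℝ, ∀ U, |v U| ≤ C) → (∀ U, v U ≠ 0 → recordChi L (1 / 6) (42 * max 1 ((Fintype.card (Site 3 L) : ℝ) / 7) + 1) M β U ≠ 0) → (∀ u, fibreInner L (softWeight (recordChi L (1 / 6) (42 * max 1 ((Fintype.card (Site 3 L) : ℝ) / 7) + 1) M β)) (recordProfile L β) v u = 0) → |tubeCross β (boFun L φ (recordProfile L β)) v| ≤ (btC L β (recordProfile L β) (btEps β) (5 * (powScale (1 / 2) β * btLog β ^ 2)) / fpZ (btEps β) / recordGamma L (recordProfile L) β * levelValue su2Rep 1 ((L : ℝ) ^ 3 * β) 0) * Real.sqrt (bA β ^ 2 * tubeNormSq (softWeight (recordChi L (1 / 6) (42 * max 1 ((Fintype.card (Site 3 L) : ℝ) / 7) + 1) M β)) (boFun L φ (recordProfile L β)) + κA * recordGamma L (recordProfile L) β * ∫ u, (if orbitDist u < max 1 ((Fintype.card (Site 3 L) : ℝ) / 7) * recordDelta1 L (1 / 6) β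 then orbitDist u ^ 2 else 0) * φ u ^ 2 ∂configMeasure SU2 1) * Real.sqrt (tubeNormSq (softWeight (recordChi L (1 / 6) (42 * max 1 ((Fintype.card (Site 3 L) : ℝ) / 7) + 1) M β)) v) ∧ |tubeCross β v (boFun L φ (recordProfile L β))| ≤ (btC L β (recordProfile L β) (btEps β) (5 * (powScale (1 / 2) β * btLog β ^ 2)) / fpZ (btEps β) / recordGamma L (recordProfile L) β * levelValue su2Rep 1 ((L : ℝ) ^ 3 * β) 0) * Real.sqrt (bA β ^ 2 * tubeNormSq (softWeight (recordChi L (1 / 6) (42 * max 1 ((Fintype.card (Site 3 L) : ℝ) / 7) + 1) M β)) (boFun L φ (recordProfile L β)) + κA * recordGamma L (recordProfile L) β * ∫ u, (if orbitDist u < max 1 ((Fintype.card (Site 3 L) : ℝ) / 7) * recordDelta1 L (1 / 6) β then orbitDist u ^ 2 else 0) * φ u ^ 2 ∂configMeasure SU2 1) * Real.sqrt (tubeNormSq (softWeight (recordChi L (1 / 6) (42 * max 1 ((Fintype.card (Site 3 L) : ℝ) / 7) + 1) M β)) v) := by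
  intro L _ hL
  obtain ⟨c₁, η, hr, hq⟩ := Summit.QuantumFields.YangMills.Theorems.FemtoTransferGap.TwoLattice.ConstTube.stub_C1rate L hL
  exact hODpot_A_of_quasimode (L := L) (nonempty_nzSite L hL) hL hq hr

/-- ★ THE CORE RATE for one `L ≥ 2` from the two analytic bricks: `recordProfile_analyticInput_of_hST_hOD` inhabits `AnalyticRatePotInput L D_L M`, then the route of record
`toRecord → boRateBricksPot_record → softTubeBORatePackagePotOn_of_bricksPot (EM) → innerRateAt_of_ratePackagePot` at level `k = 1`. [cite: Luscher1983, §3] -/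
theorem coreRate (L : ℕ) [NeZero L] (hL : 2 ≤ L) :
    ∃ C βc : ℝ, ∀ β : ℝ, βc ≤ β →
      ∀ F : Fin 2 → (GaugeConfig 3 L SU2 → ℝ), (∀ i, IsPhys (F i)) →
        (∀ i U, F i U ≠ 0 → ∃ z : Fin 3 → Bool, orbitDist (TT.twist3 z U) < powScale (1 / 6) β) →
        (∀ a : Fin 2 → ℝ, a ≠ 0 → 0 < l2 (fun U => ∑ i, a i * F i U) (fun U => ∑ i, a i * F i U)) →
          ∃ a : Fin 2 → ℝ, a ≠ 0 ∧
            qform su2Rep β (fun U => ∑ i, a i * F i U) (fun U => ∑ i, a i * F i U) * levelValue su2Rep 1 ((L : ℝ) ^ 3 * β) 0 ≤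
              Real.exp (C * bareLambda ((L : ℝ) ^ 3 * β) ^ 2) * levelValue su2Rep 1 ((L : ℝ) ^ 3 * β) 1 *
                levelValue su2Rep L β 0 * l2 (fun U => ∑ i, a i * F i U) (fun U => ∑ i, a i * F i U) := by
  have hNz := nonempty_nzSite L hL
  have hD1 : (1 : ℝ) ≤ max 1 ((Fintype.card (Site 3 L) : ℝ) / 7) := le_max_left _ _
  have hD7 : (Fintype.card (Site 3 L) : ℝ) ≤ 7 * max 1 ((Fintype.card (Site 3 L) : ℝ) / 7) := by
    have := le_max_right (1 : ℝ) ((Fintype.card (Site 3 L) : ℝ) / 7); linarith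
  obtain ⟨M₀, hM₀, hP⟩ := recordProfile_analyticInput_of_hST_hOD (L := L) hL hNz hD1 (fun β => 5 * (powScale (1 / 2) β * btLog β ^ 2))
  obtain ⟨M₁, hST⟩ := Summit.QuantumFields.YangMills.Theorems.FemtoTransferGap.TwoLattice.ConstTube.stub_hST_A L hL
  obtain ⟨M₂, hOD⟩ := hODpot_A L hL
  obtain ⟨θA, hθA0, hθA1, hSTM⟩ := hST (max M₀ (max M₁ M₂)) ((le_max_left _ _).trans (le_max_right _ _))
  obtain ⟨bA, κA, hκA, hbA0, hbAs, hODM⟩ := hOD (max M₀ (max M₁ M₂)) ((le_max_right _ _).trans' (le_max_right _ _))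
  obtain ⟨I⟩ := hP (max M₀ (max M₁ M₂)) (le_max_left _ _) θA hθA0 hθA1 hSTM bA κA hκA hbA0 hbAs hODM
  have hM2 : (2 : ℝ) ≤ max M₀ (max M₁ M₂) := hM₀.trans (le_max_left _ _)
  exact innerRateAt_of_ratePackagePot (L := L) 1 (fun β => powScale_pos (1 / 6) β) powScale_sixth_eventually_le
    (softTubeAdmissible_recordChi' (1 / 6) (42 * max 1 ((Fintype.card (Site 3 L) : ℝ) / 7) + 1) (max M₀ (max M₁ M₂)) (by linarith) hM2)
    (softTubeBORatePackagePotOn_of_bricksPot oneSiteEigenMoments (boRateBricksPot_record (by norm_num) (by linarith) (I.toRecord hD1 hD7 (by linarith))))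

/-- ★★★★ **The crux K1 `NearFlatRatioLaw` BY NAME**: the core rate for every `L ≥ 2` (`coreRate`: ✓`ConstTube.stub_hST_A` + `hODpot_A` (← ✓`ConstTube.stub_C1rate`) through the analytic rate input of record) and lane A's
SHELL (`shellGain_sixth`), glued by the rate two-zone lemma `nearFlatRatioLaw_of_coreRate_shell_pow` (IMS cut at `β^{-1/6}` costing
`O(λ_b²)λ₀`). -/
theorem _root_.Summit.QuantumFields.YangMills.Theorems.FlatTubeReduction.nearFlatRatioLaw_proof : Summit.QuantumFields.YangMills.Theses.FlatTubeReduction.NearFlatRatioLaw :=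
  nearFlatRatioLaw_of_coreRate_shell_pow (fun L _ hL => coreRate L hL) (fun L _ hL => shellGain_sixth L hL)

end Summit.QuantumFields.YangMills.Theorems.FemtoTransferGap.RateTube.NearFlatRatioLawLine

end
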